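import Summits.BirchSwinnertonDyer.BirchSwinnertonDyer.Theorems.GenusKolyvaginAtTwoK4NegLwClassLevelTwoValues
import Literature.NumberTheory.EllipticCurves.OrdinaryReductionTorsionLineProofs
import HarnessLib

/-!
# Route `GenusKolyvaginAtTwo`, K₄⁻ kernel `K4Neg` (stmt-BirchSwinnertonDyer-31526), LINE 34 «twin_bsd_road⁻» v1.5 (F4ᵖᵍ census):
# THE ORDINARY WITNESS AT `v ∣ 2` — Kummer classes at a good place are inertially trivial modulo the kernel of reduction, so an
# inertia element acting as `−1` on the canonical `4`-torsion line (and trivially on `E[2]`) is a LEVEL-2 WITNESS for the Lawson–Wuthrich class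

Width seat `bsd-line-gk2-p5` g42 (cell `bsd-f1-sign2`), WIDTH-5 attach on route `GenusKolyvaginAtTwo` rev 59, lane `(NPh_K)` off
the cut.  `--supports stmt-BirchSwinnertonDyer-31526 --as helper`.  THEOREMS ONLY (no definition, no named fact, no `sorry`); standard
axioms.  **BSD is NOT proved by this file; `K4Neg` is NOT proved; no item is closed by it.**

WHAT.  Off the cut, `(NPh_K)` at a `2`-split frame is the bit «the Lawson–Wuthrich class `ξ_E` is NOT a Kummer class at `ℚ₂`» (gk2-p4
g32 `TwoAdic.nonPhantom_pow_iff_forall_not_mem_selmerLocalKer_two_of_offCut`).  Two WITNESS mechanisms for that bit are in the tree: the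
Tate transvection at a `2`-MULTIPLICATIVE place (gk2-p5 g41) and, for `Δ > 0`, the real place (gk2-p4 g32); the pen's LINE 34 v1.5 §6
reads the rest of the habitat («not multiplicative at `2`») as NPh-dead from data (LW2, kit j339762: 32/32 cells, 16 of them good and
all SUPERSINGULAR).  This file adds a THIRD mechanism, at a place of GOOD ORDINARY reduction above `2`:
* §1 ★ `apply_reduction_h1Eval_absGaloisRestrict_eq_zero_of_mem_selmerLocalKer` — **Kummer classes are inertially trivial modulo the
  kernel of reduction**: for `E` over a number field `K`, ANY place `v` of good reduction, ANY `n`, a class `x ∈ H¹(K, E[n])` in the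
  local Kummer image at `v` and `τ` in the inertia group `I_{K_v}`: the value `[x, res τ] ∈ E[n]` (of the representing cocycle) REDUCES
  TO `Õ` (`x = δ(P)` locally, `[x, τ] = τa − a` with `n a = P`, and inertia does not move reductions — the tree's
  `reducePoint_congrEquiv_map_eq`).  In the local model frame of `exists_goodReduction_localModel` / `goodReduction_reduction_line`.
* §2 ★★ `not_mem_selmerLocalKer_two_of_inertia_datum_comp_ne_zero` — **THE ORDINARY WITNESS CRITERION over `ℚ`**: `W/ℚ` elliptic with
  `ρ̄_{W,2}`, `ρ_{W,4}` onto, `v ∋ 2` of good ORDINARY reduction, `x ≠ 0` the class dying on `Γ_{ℚ(E[4])}`.  If some INERTIA element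
  `τ ∈ I_{ℚ₂}` fixes `E[2]` and acts on `E[4]` as `P ↦ P + A(2P)` with `A ∘ A ≠ 0` (⟺ `τ` acts as `−1` on the `4`-torsion of the
  canonical line, i.e. `χ₄(τ) = −1`, while `A(E[2]) ⊆ Λ` is automatic for inertia), then **`x ∉ 𝓛_v`: the Lawson–Wuthrich class is NOT
  a Kummer class at `v`** — a level-2 witness at `v ∣ 2`, hence `(NPh_K)` at every `2`-split Heegner frame by gk2-p4 g31/g32's iff.
  Proof: inertia acts on `E[4]` by translations INTO the kernel-of-reduction line `Λ = {0, T₀}` (`goodReduction_reduction_line`: inertia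
  invariance + the ordinary count `#(ker ∩ E[2]) = 2`), so `A(E[2]) ⊆ Λ` and the LINE LAW of `…LwClassLevelTwoValues`
  (`h1Eval_mem_line_iff_of_datum_of_forall`) gives `[x, res τ] ∈ Λ ⟺ A T₀ = 0 ⟺ A ∘ A = 0`; §1 forbids `[x, res τ] ∉ Λ` for a Kummer class.
READING (LINE 34 v1.5 census; nothing closed).  `τ` as in §2 exists iff the inertia group of `ℚ₂(E[4])/ℚ₂` contains an element trivial on
`E[2]` with `χ₄ = −1`; for good ordinary `E/ℚ₂` (`ℚ₂(E[2]) = ℚ₂(√Δ)`) this is «`ℚ₂(√Δ)/ℚ₂` unramified», i.e. `Δ_min ≡ 1 (mod 4)` — so the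
NPh road is ALIVE on the good-ordinary `Δ_min ≡ 5 (mod 8)` cells of the K₄⁻ off-cut habitat (`v₃(Δ_min)` odd; none below `5·10⁵` in
LW2, whose 16 good cells are all supersingular), a structural correction to «F4ᵖᵍ = not multiplicative at 2».  The discharge
«`Δ ≡ 1 (4)` ⟹ such `τ`» (χ₄ on inertia, `E[2]` unramified) is NOT in this file.  BSD is NOT proved by any of this.

References: [SerreInventiones1972] §1.11 Prop. 11 and Cor.; [SilvermanAEC2009] VII.2.1, VIII.§1, X.§4; [LawsonWuthrich2016] §3, §7.1;
[GrossLMS1991] §9 Prop. 9.1.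
-/

set_option linter.dupNamespace false -- `Summit.<P>.<Sub>` repeats `BirchSwinnertonDyer` (D-0017)
set_option autoImplicit false

noncomputable section

open scoped Classical NNReal NumberField

namespace Summit.BirchSwinnertonDyer.BirchSwinnertonDyer.Theorems.GenusExact.Lw2PhantomExclusion.OrdinaryWitness

open WeierstrassCurve Field NumberField IsDedekindDomain
open Literature.NumberTheory.GaloisRepresentations Literature.NumberTheory.EllipticCurves
open Literature.NumberTheory IsDedekindDomain.HeightOneSpectrum
open Summit.BirchSwinnertonDyer.BirchSwinnertonDyer.Theorems.GenusKolyTwistingPrime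
open Summit.BirchSwinnertonDyer.BirchSwinnertonDyer.Theorems.GenusExact.Lw2PhantomExclusion.LevelTwoValues

/-! ## §1 ★ Kummer classes are inertially trivial modulo the kernel of reduction (any good place, any level) -/

section Local

/-- ★ **KUMMER CLASSES ARE INERTIALLY TRIVIAL MODULO THE KERNEL OF REDUCTION.**  `E` elliptic over a number field `K`, `v` a finite place
of GOOD reduction, `n : ℤ` any level; the local good-reduction frame of `exists_goodReduction_localModel` (`w`, `φ`, `hX`, `Φ₀`) and the
reduction map `f = red ∘ Φ ∘ pointsMap : E(K̄) → Ẽ(k̄_w)` of `goodReduction_reduction_line`.  If `x ∈ H¹(K, E[n])` lies in the local Kummer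
image at `v` (`selmerLocalKer`), then for every `τ` in the INERTIA group `I_{K_v}` the value `[x, res τ]` of its representing cocycle
reduces to `Õ`: **`f [x, res τ] = 0`**.  (Locally `x = δ(a)`: `[x, τ] = τa − a`, and `τa`, `a` have the same reduction because inertia moves
`w`-integers within their residue classes — `reducePoint_congrEquiv_map_eq`.)  At `v ∤ n` this is the unramifiedness of Kummer classes; at
`v ∣ n` ORDINARY it confines `[x, res τ]` to the kernel-of-reduction LINE. [cite: SilvermanAEC2009, VII.2.1, VIII.§1 (inertia acts trivially on Ẽ), X.§4]
[cite: SerreInventiones1972, §1.11 Prop. 11] -/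
theorem apply_reduction_h1Eval_absGaloisRestrict_eq_zero_of_mem_selmerLocalKer {K : Type} [Field K] [NumberField K]
    (W : WeierstrassCurve K) [W.IsElliptic] (v : HeightOneSpectrum (𝓞 K))
    {w : Valuation (AlgebraicClosure (v.adicCompletion K)) ℝ≥0}
    (hw : ∀ z, (w z : ℝ) = spectralNorm (v.adicCompletion K) (AlgebraicClosure (v.adicCompletion K)) z)
    {φ : v.adicCompletionIntegers K →+* w.valuationSubring}
    (hΔO : IsUnit ((W.localMinimalIntegralModel v).map φ).Δ)
    (hX : ((W.localMinimalIntegralModel v).map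
        (algebraMap (v.adicCompletionIntegers K) (v.adicCompletion K))).baseChange
          (AlgebraicClosure (v.adicCompletion K)) =
        ((W.localMinimalIntegralModel v).map φ).baseChange (AlgebraicClosure (v.adicCompletion K)))
    (Φ₀ : localPoints W (v.adicCompletion K) ≃+
      (((W.localMinimalIntegralModel v).map
        (algebraMap (v.adicCompletionIntegers K) (v.adicCompletion K))).baseChange
          (AlgebraicClosure (v.adicCompletion K))).toAffine.Point)
    (hΦ₀ : ∀ (σ : absoluteGaloisGroup (v.adicCompletion K)) (Q : localPoints W (v.adicCompletion K)),
      Φ₀ (σ • Q) = Affine.Point.map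
        ((absoluteGaloisGroup.toAlgEquiv (v.adicCompletion K) σ :
            AlgebraicClosure (v.adicCompletion K) ≃ₐ[v.adicCompletion K]
              AlgebraicClosure (v.adicCompletion K)) :
          AlgebraicClosure (v.adicCompletion K) →ₐ[v.adicCompletion K]
            AlgebraicClosure (v.adicCompletion K)) (Φ₀ Q))
    (f : geomPoints W →+
      (((W.localMinimalIntegralModel v).map φ).map (IsLocalRing.residue w.valuationSubring)).toAffine.Point)
    (hf : ∀ a, f a = goodReductionHom ((W.localMinimalIntegralModel v).map φ)
      (Valuation.valuationSubring.integers w) hΔO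
      (Affine.Point.congrEquiv hX (Φ₀ (pointsMap W (v.adicCompletion K) a))))
    (n : ℤ) {x : galH1Torsion W n} (hx : x ∈ selmerLocalKer W (v.adicCompletion K) n)
    {τ : absoluteGaloisGroup (v.adicCompletion K)} (hτ : τ ∈ absInertia (v.adicCompletion K)) :
    f ((h1Eval W n x (absGaloisRestrict K (v.adicCompletion K) τ) : geomTorsion W n) : geomPoints W) = 0 := by
  have hvO : w.Integers w.valuationSubring := Valuation.valuationSubring.integers w
  let σE : absoluteGaloisGroup (v.adicCompletion K) →
      (AlgebraicClosure (v.adicCompletion K) →ₐ[v.adicCompletion K]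
        AlgebraicClosure (v.adicCompletion K)) := fun σ ↦
    ((absoluteGaloisGroup.toAlgEquiv (v.adicCompletion K) σ :
        AlgebraicClosure (v.adicCompletion K) ≃ₐ[v.adicCompletion K]
          AlgebraicClosure (v.adicCompletion K)) :
      AlgebraicClosure (v.adicCompletion K) →ₐ[v.adicCompletion K]
        AlgebraicClosure (v.adicCompletion K))
  -- `Γ_{K_v}` acts by isometries, inertia moves integers within `𝓂_w`
  have hσ₁ : ∀ (σ : absoluteGaloisGroup (v.adicCompletion K))
      (z : AlgebraicClosure (v.adicCompletion K)), w (σE σ z) = w z :=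
    fun σ z ↦ spectralValuation_smul hw σ z
  have hσ₂ : ∀ σ ∈ absInertia (v.adicCompletion K),
      ∀ z : AlgebraicClosure (v.adicCompletion K), w z ≤ 1 → w (σE σ z - z) < 1 := by
    intro σ hσ z hz
    rw [mem_absInertia_iff_algNorm] at hσ
    exact (spectralValuation_lt_one_iff_algNorm_lt_one hw _).mpr
      (hσ z ((spectralValuation_le_one_iff_algNorm_le_one hw z).mp hz))
  -- unpack the Kummer condition: `[x, res g] = g a - a` in `E(K̄_v)` for a local point `a`
  have hx' := hx
  rw [← oneCocycleClass_reprCocycle W n x, WeierstrassCurve.selmerLocalKer, oneCocycleClass_mem_resKer_iff] at hx'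
  obtain ⟨a, ha⟩ := hx'
  have hval : pointsMap W (v.adicCompletion K)
      ((h1Eval W n x (absGaloisRestrict K (v.adicCompletion K) τ) : geomTorsion W n) : geomPoints W) = τ • a - a := by
    have h := ha τ
    simp only [AddMonoidHom.coe_comp, AddSubgroup.coe_subtype, Function.comp_apply] at h
    rw [← resGal_eq_absGaloisRestrict]
    exact h
  -- reduce: `red (Φ (τ a)) = red (Φ a)` by inertia invariance
  rw [hf, hval, map_sub, map_sub, map_sub, hΦ₀, goodReductionHom_apply, goodReductionHom_apply, sub_eq_zero]
  exact reducePoint_congrEquiv_map_eq _ hX (σE τ) (hσ₁ τ) (hσ₂ τ hτ) _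

end Local

/-! ## §2 ★★ The ordinary witness criterion over `ℚ` -/

section Ordinary

variable (W : WeierstrassCurve ℚ) [W.IsElliptic]

/-- ★★ **THE ORDINARY WITNESS CRITERION AT `v ∣ 2`.**  `W/ℚ` elliptic with `ρ̄_{W,2}` and `ρ_{W,4}` onto; `v` the place over `2`, of GOOD
ORDINARY reduction (`2 ∤ a_v`); `x ∈ H¹(ℚ, E[2])` the non-zero class dying on `Γ_{ℚ(E[4])}` (the Lawson–Wuthrich class).  If some element
`τ` of the INERTIA group `I_{ℚ_v}` has `res τ` acting on `E[4]` as `P ↦ P + A(2P)` (so trivially on `E[2]`) with **`A ∘ A ≠ 0`** — for inertia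
`A(E[2]) ⊆ Λ` (the kernel-of-reduction line) is automatic, so this says `A T₀ ≠ 0`: `τ` acts as `−1` on the `4`-torsion of the canonical
line, `χ₄(τ) = −1` — then **`x ∉ selmerLocalKer W ℚ_v 2`: the Lawson–Wuthrich class is NOT a Kummer class at `v`**, i.e. `v` is a level-2
witness and `(NPh_K)` holds at every `2`-split frame (gk2-p4's iff).  Proof: §1 puts `[x, res τ]` in `Λ = ker(red) ∩ E[2]`, a LINE for
ordinary reduction (`goodReduction_reduction_line`), while the LINE LAW of `…LwClassLevelTwoValues` gives `[x, res τ] ∈ Λ ⟺ A T₀ = 0 ⟺ A∘A = 0`.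
[cite: SerreInventiones1972, §1.11 Prop. 11 and Cor.] [cite: LawsonWuthrich2016, §3, §7.1] [cite: SilvermanAEC2009, VII.2.1, VIII.§1, X.§4] -/
theorem not_mem_selmerLocalKer_two_of_inertia_datum_comp_ne_zero
    (hsurj : W.HasSurjectiveModNGaloisRep 2) (hsurj4 : W.HasSurjectiveModNGaloisRep 4)
    (v : HeightOneSpectrum (𝓞 ℚ)) (hv2 : ((2 : ℕ) : 𝓞 ℚ) ∈ v.asIdeal) (hgood : W.HasGoodReductionAt v)
    (hord : ¬ (((2 : ℕ) : ℤ) ∣ W.frobeniusTraceAt v))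
    {x : galH1Torsion W (2 : ℤ)} (hx0 : x ≠ 0) (hx : ∀ h ∈ torsionFixing W (4 : ℤ), h1Eval W (2 : ℤ) x h = 0)
    {τ : absoluteGaloisGroup (v.adicCompletion ℚ)} (hτ : τ ∈ absInertia (v.adicCompletion ℚ))
    {A : geomTorsion W (2 : ℤ) →+ geomTorsion W (2 : ℤ)}
    (hA : ∀ P : geomTorsion W (4 : ℤ),
      ((absGaloisRestrict ℚ (v.adicCompletion ℚ) τ • P : geomTorsion W (4 : ℤ)) : geomPoints W) =
        (P : geomPoints W) + (A ⟨(2 : ℤ) • (P : geomPoints W), two_zsmul_mem_geomTorsion_two W P⟩ : geomPoints W))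
    (hAA : A.comp A ≠ 0) :
    x ∉ selmerLocalKer W (v.adicCompletion ℚ) (2 : ℤ) := by
  haveI : Fact (Nat.Prime 2) := ⟨Nat.prime_two⟩
  -- the local good-reduction frame and the reduction map on `E(ℚ̄)`
  obtain ⟨w, hw, φ, Φ₀, hX, _, hΔO, hΦ₀⟩ := exists_goodReduction_localModel W v hgood
  set f : geomPoints W →+ (((W.localMinimalIntegralModel v).map φ).map
      (IsLocalRing.residue w.valuationSubring)).toAffine.Point :=
    (goodReductionHom ((W.localMinimalIntegralModel v).map φ)
      (Valuation.valuationSubring.integers w) hΔO).comp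
      (((Φ₀.trans (Affine.Point.congrEquiv hX)).toAddMonoidHom).comp
        (pointsMap W (v.adicCompletion ℚ))) with hfdef
  have hf : ∀ a, f a = goodReductionHom ((W.localMinimalIntegralModel v).map φ)
      (Valuation.valuationSubring.integers w) hΔO
      (Affine.Point.congrEquiv hX (Φ₀ (pointsMap W (v.adicCompletion ℚ) a))) := fun a ↦ rfl
  obtain ⟨-, hinv, hcard⟩ := goodReduction_reduction_line W 2 v hv2 hgood hord hw hΔO hX Φ₀ hΦ₀ f hf
  set ρ := absGaloisRestrict ℚ (v.adicCompletion ℚ) τ with hρdef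
  -- ### the kernel-of-reduction LINE `Λ = ker f ∩ E[2] = {0, T₀}`
  have hcard2 : Nat.card ↥(f.ker ⊓ geomTorsion W (2 : ℤ)) = 2 := hcard
  obtain ⟨u₁, u₂, hne, huniv⟩ := Nat.card_eq_two_iff.mp hcard2
  -- one of `u₁, u₂` is `0`; call the other one `T₀`
  have hmemΛ : ∀ S : geomTorsion W (2 : ℤ), (S : geomPoints W) ∈ f.ker →
      ∃ u : ↥(f.ker ⊓ geomTorsion W (2 : ℤ)), (u : geomPoints W) = S := fun S hS ↦
    ⟨⟨S, AddSubgroup.mem_inf.mpr ⟨hS, S.2⟩⟩, rfl⟩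
  have htwo : ∀ u : ↥(f.ker ⊓ geomTorsion W (2 : ℤ)), u = u₁ ∨ u = u₂ := fun u ↦ by
    have hu : u ∈ ({u₁, u₂} : Set _) := by rw [huniv]; exact Set.mem_univ u
    simpa using hu
  obtain ⟨T₀', hT₀'ne, hT₀'all⟩ : ∃ T : ↥(f.ker ⊓ geomTorsion W (2 : ℤ)), T ≠ 0 ∧
      ∀ u : ↥(f.ker ⊓ geomTorsion W (2 : ℤ)), u = 0 ∨ u = T := by
    by_cases h1 : u₁ = 0
    · refine ⟨u₂, fun h ↦ hne (h1.trans h.symm), fun u ↦ ?_⟩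
      rcases htwo u with h | h
      · exact Or.inl (h.trans h1)
      · exact Or.inr h
    · refine ⟨u₁, h1, fun u ↦ ?_⟩
      rcases htwo u with h | h
      · exact Or.inr h
      · -- `u = u₂`; then `u₁ ≠ 0` and `u₂` must be `0` or we contradict `#Λ = 2` via `0 ∈ Λ`
        rcases htwo 0 with h0 | h0
        · exact absurd h0.symm h1
        · exact Or.inl (h.trans h0.symm)
  let T₀ : geomTorsion W (2 : ℤ) := ⟨(T₀' : geomPoints W), (AddSubgroup.mem_inf.mp T₀'.2).2⟩
  have hT₀ : T₀ ≠ 0 := by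
    intro h
    apply hT₀'ne
    apply Subtype.ext
    have h' : ((T₀ : geomTorsion W (2 : ℤ)) : geomPoints W) = ((0 : geomTorsion W (2 : ℤ)) : geomPoints W) :=
      congrArg Subtype.val h
    exact h'
  have hline : ∀ S : geomTorsion W (2 : ℤ), (S : geomPoints W) ∈ f.ker → S = 0 ∨ S = T₀ := by
    intro S hS
    obtain ⟨u, hu⟩ := hmemΛ S hS
    rcases hT₀'all u with h | h
    · left
      exact Subtype.ext (by rw [← hu, h]; rfl)
    · right
      exact Subtype.ext (by rw [← hu, h])
  -- ### inertia acts on `E[4]` by translations INTO `Λ`: `A(E[2]) ⊆ Λ`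
  have hAker : ∀ S : geomTorsion W (2 : ℤ), ((A S : geomTorsion W (2 : ℤ)) : geomPoints W) ∈ f.ker := by
    intro S
    -- halve `S` in `E[4]`
    obtain ⟨P, hP0⟩ := W.zsmul_geomPoints_surjective_of_charZero (n := (2 : ℤ)) two_ne_zero (S : geomPoints W)
    have hP : (2 : ℤ) • P = (S : geomPoints W) := hP0
    have hP4 : P ∈ geomTorsion W (4 : ℤ) := by
      rw [WeierstrassCurve.mem_geomTorsion_iff, show (4 : ℤ) = 2 * 2 by norm_num, mul_zsmul]
      change (2 : ℤ) • ((2 : ℤ) • P) = 0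
      rw [hP]
      exact (WeierstrassCurve.mem_geomTorsion_iff W 2 _).mp S.2
    have hS : (⟨(2 : ℤ) • ((⟨P, hP4⟩ : geomTorsion W (4 : ℤ)) : geomPoints W),
        two_zsmul_mem_geomTorsion_two W ⟨P, hP4⟩⟩ : geomTorsion W (2 : ℤ)) = S := Subtype.ext hP
    have h := hA ⟨P, hP4⟩
    rw [hS] at h
    -- `A S = ρ P - P`, killed by `f` (inertia invariance)
    have hAS : ((A S : geomTorsion W (2 : ℤ)) : geomPoints W) = ρ • P - P := by
      rw [eq_sub_iff_add_eq, add_comm, ← h]; rfl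
    rw [AddMonoidHom.mem_ker, hAS, map_sub, hρdef, hinv τ hτ, sub_self]
  have hAline : ∀ S : geomTorsion W (2 : ℤ), A S = 0 ∨ A S = T₀ := fun S ↦ hline (A S) (hAker S)
  -- ### `A ∘ A ≠ 0` forces `A T₀ ≠ 0`
  have hAT₀ : A T₀ ≠ 0 := by
    intro h0
    apply hAA
    refine AddMonoidHom.ext fun S ↦ ?_
    rw [AddMonoidHom.comp_apply, AddMonoidHom.zero_apply]
    rcases hAline S with h | h
    · rw [h, map_zero]
    · rw [h, h0]
  -- ### the LINE LAW: `[x, ρ] ∉ Λ`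
  have hnot : ¬ (h1Eval W (2 : ℤ) x ρ = 0 ∨ h1Eval W (2 : ℤ) x ρ = T₀) := fun h ↦
    hAT₀ ((h1Eval_mem_line_iff_of_datum_of_forall W hsurj hsurj4 hx0 hx hA hT₀ hAline).mp h)
  -- ### §1: a Kummer class would have `[x, ρ] ∈ Λ`
  intro hxin
  apply hnot
  exact hline _ (by
    rw [AddMonoidHom.mem_ker]
    exact apply_reduction_h1Eval_absGaloisRestrict_eq_zero_of_mem_selmerLocalKer W v hw hΔO hX Φ₀ hΦ₀ f hf
      (2 : ℤ) hxin hτ)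

end Ordinary

end Summit.BirchSwinnertonDyer.BirchSwinnertonDyer.Theorems.GenusExact.Lw2PhantomExclusion.OrdinaryWitness

end
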